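import Literature.Analysis.FluidPDE.PassiveScalarEnergyPointwise
import Literature.Analysis.FluidPDE.PassiveScalarSpectralBounds
import Literature.Analysis.FluidPDE.PassiveScalarSteadyTest
import Literature.Analysis.FluidPDE.PassiveScalarClassicalEnergy
import Literature.Analysis.FunctionSpaces.TorusSpaceTime
import HarnessLib

/-!
# An inviscid criterion for anomalous dissipation of weak passive scalars
# (Drivas–Elgindi–Iyer–Jeong 2022, Prop. 1.3, in the inviscid `H²` form of Elgindi–Liss)

Analysis/FluidPDE proof-support file (everything proved; no named facts); first step of the
discharge of `Literature.Analysis.FluidPDE.deij_anomalous_dissipation_eventually`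
(`TurbPassiveScalar.lean`; Drivas–Elgindi–Iyer–Jeong, ARMA 243 (2022), Thm. 2), whose statement
quantifies over *all weak solutions* `Torus.IsWeakScalarTransportOn` of `∂ₜθ + u·∇θ = κΔθ`.
The criterion of the source (Prop. 1.3, proved in §2.1 by comparing `θ^κ` with the inviscid
solution `θ`) is recast here so that (i) only the *inviscid* solution carries hypotheses — the
balanced growth `‖Δg(t)‖_{L²} ≤ C ‖∇g(t)‖²_{L²}` of Elgindi–Liss, ARMA 248 (2024)
(arXiv:2309.08576), Prop. 2.1 with `σ = 2` — and (ii) the viscous solution is an arbitrary weak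
solution in `L^∞_t L²_x`:

* `Torus.IsWeakScalarTransportOn.of_le` — restriction of the time horizon of a weak solution;
* `Torus.IsWeakScalarTransportOn.setIntegral_test_mul_spaceTime`,
  `Torus.IsWeakScalarTransportOn.ae_integral_mul_classical_eq` — the weak formulation tested with
  `η(t) G(t,x)` for a jointly smooth `G`, and the **duality identity**
  `∫ θ(t) G(t) = ∫ θ₀ G(0) + κ ∫₀ᵗ ∫ θ ΔG` for a.e. `t` when `∂ₜG + u·∇G = 0` (the computation
  `d/dt ½|θ - θ^κ|² = …` of the source, §2.1, in weak form; a.e. du Bois-Reymond lemma of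
  `FunctionSpaces.DuBoisReymondAE`);
* `Torus.DEIJ.ofReal_scalarGradNormSq_div_four_le` — **the slice estimate**: balanced growth of a
  smooth `G` and `C ‖θ - G‖_{L²} < 1/2` force `‖∇θ‖² ≥ ‖∇G‖²/4` (spectral gradient norm of `θ`;
  `‖∇G‖² = -∫GΔG = -∫θΔG + ∫(θ - G)ΔG`, the `Ḣ¹ × Ḣ¹` pairing bound
  `Torus.enorm_integral_mul_laplacian_le` and Cauchy–Schwarz);
* `Torus.DEIJ.le_eScalarDissipation_of_balanced_growth` — **the criterion**: if `u` is bounded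
  and measurable on `(0,T) × T^d`, the inviscid scalar `g` is, on every `[0,T₁]`, `T₁ < T`, a
  jointly smooth classical solution of the transport equation, `‖g(t)‖_{L²} ≤ ‖g(0)‖_{L²}`,
  `∫₀ᵗ‖∇g‖² → ∞` as `t → T` and `‖Δg(t)‖_{L²} ≤ C‖∇g(t)‖²_{L²}`, then every weak solution with
  `κ > 0` and `L²` datum `θ₀`, `‖θ₀ - g(0)‖²_{L²} ≤ 1/(8C²)`, has
  `κ∫₀ᵀ‖∇θ‖²_{L²} ≥ 1/(32C²)` — for *every* `κ > 0` (the energy inequality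
  `Torus.IsWeakScalarTransportOn.lintegral_sq_add_le_holds` replaces the energy equality of
  classical solutions; the closeness `‖θ₀ - g(0)‖` allows the inviscid datum to be a smooth
  approximation of `θ₀ ∈ H²`).

## References

* T. D. Drivas, T. M. Elgindi, G. Iyer, I.-J. Jeong, *Anomalous dissipation in passive scalar
  transport*, Arch. Ration. Mech. Anal. 243 (2022) 1151–1180 (arXiv:1911.03271), Prop. 1.3,
  §2.1. [`DrivasEtAl2022`]
* T. M. Elgindi, K. Liss, *Norm growth, non-uniqueness, and anomalous dissipation in passive
  scalars*, Arch. Ration. Mech. Anal. 248 (2024) (arXiv:2309.08576), Prop. 2.1. [`ElgindiLiss2024`]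
* R. J. DiPerna, P.-L. Lions, Invent. Math. 98 (1989), §II.1 (13)–(14). [`DiPernaLions1989`]
-/

noncomputable section

open MeasureTheory TopologicalSpace Set Function Filter Topology UnitAddTorus
open scoped ENNReal NNReal InnerProductSpace ContDiff

namespace Literature.Analysis.FluidPDE

namespace Torus

variable {d : Type*} [Fintype d]

/-! ## Small calculus helpers -/

namespace DEIJ

omit [Fintype d] in
/-- The two-sided time derivative of a field vanishing on a time-neighbourhood vanishes. [folklore] -/
theorem timeDeriv_eq_zero_of_forall_eq_zero {F : Type*} [NormedAddCommGroup F] [NormedSpace ℝ F]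
    {ψ : ℝ → UnitAddTorus d → F} {T' t : ℝ} (hψ : ∀ s, T' ≤ s → ψ s = 0) (ht : T' < t)
    (x : UnitAddTorus d) : FunctionSpaces.Torus.timeDeriv ψ t x = 0 := by
  have hev : (fun s => ψ s x) =ᶠ[𝓝 t] fun _ => (0 : F) := by
    filter_upwards [Ioi_mem_nhds ht] with s hs
    simp [hψ s (le_of_lt hs)]
  rw [FunctionSpaces.Torus.timeDeriv, hev.deriv_eq, deriv_const]

end DEIJ

/-! ## Restricting the time horizon of a weak solution -/

namespace IsWeakScalarTransportOn

variable {T κ : ℝ} {u : ℝ → UnitAddTorus d → EuclideanSpace ℝ d} {θ₀ : UnitAddTorus d → ℝ}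
  {θ : ℝ → UnitAddTorus d → ℝ}

/-- **Restriction of the horizon.** A weak solution on `T^d × [0,T)` is a weak solution on
`T^d × [0,T₁)` for every `T₁ ≤ T` (test functions for the shorter horizon are test functions for
the longer one, and the weak integrand vanishes after their support). [folklore] -/
theorem of_le (h : IsWeakScalarTransportOn T κ u θ₀ θ) {T₁ : ℝ} (hT₁ : T₁ ≤ T) :
    IsWeakScalarTransportOn T₁ κ u θ₀ θ where
  aestronglyMeasurable :=
    h.aestronglyMeasurable.mono_measure
      (Measure.restrict_mono (prod_mono (Ioo_subset_Ioo_right hT₁) subset_rfl) le_rfl)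
  aestronglyMeasurable_velocity :=
    h.aestronglyMeasurable_velocity.mono_measure
      (Measure.restrict_mono (prod_mono (Ioo_subset_Ioo_right hT₁) subset_rfl) le_rfl)
  ae_lintegral_sq_le := by
    obtain ⟨C, hC⟩ := h.ae_lintegral_sq_le
    exact ⟨C, ae_restrict_of_ae_restrict_of_subset (Ioo_subset_Ioo_right hT₁) hC⟩
  lintegral_velocity_lt_top :=
    lt_of_le_of_lt (lintegral_mono_set (Ioo_subset_Ioo_right hT₁)) h.lintegral_velocity_lt_top
  lintegral_mul_lt_top :=
    lt_of_le_of_lt (lintegral_mono_set (Ioo_subset_Ioo_right hT₁)) h.lintegral_mul_lt_top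
  ae_isWeaklyDivFree := ae_restrict_of_ae_restrict_of_subset (Ioo_subset_Ioo_right hT₁) h.ae_isWeaklyDivFree
  weak_eq ψ hψ := by
    obtain ⟨T', hT'lt, hT'⟩ := hψ.2
    have hψT : FunctionSpaces.Torus.IsSpaceTimeTest T ψ := ⟨hψ.1, T', hT'lt.trans_le hT₁, hT'⟩
    have key := h.weak_eq ψ hψT
    set I : ℝ → ℝ := fun t => ∫ x, θ t x *
      (FunctionSpaces.Torus.timeDeriv ψ t x + ⟪u t x, FunctionSpaces.Torus.gradient (ψ t) x⟫_ℝ +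
        κ * FunctionSpaces.Torus.laplacian (ψ t) x) with hI
    have hI0 : ∀ t, T' < t → I t = 0 := by
      intro t ht
      simp only [hI]
      refine integral_eq_zero_of_ae (Eventually.of_forall fun x => ?_)
      have h1 : FunctionSpaces.Torus.timeDeriv ψ t x = 0 := DEIJ.timeDeriv_eq_zero_of_forall_eq_zero hT' ht x
      have h2 : ψ t = 0 := hT' t ht.le
      have hl : FunctionSpaces.Torus.liftAt (0 : UnitAddTorus d → ℝ) x = fun _ => 0 := by
        funext v; simp [FunctionSpaces.Torus.liftAt_apply]
      have h3 : FunctionSpaces.Torus.gradient (0 : UnitAddTorus d → ℝ) x = 0 := by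
        rw [FunctionSpaces.Torus.gradient, hl, gradient_fun_const]
      have h4 : FunctionSpaces.Torus.laplacian (0 : UnitAddTorus d → ℝ) x = 0 := by
        rw [FunctionSpaces.Torus.laplacian, hl, InnerProductSpace.laplacian_const]; rfl
      simp [h1, h2, h3, h4]
    have hint : IntegrableOn I (Ioo 0 T) volume := (h.integrable_weakIntegrand hψT).integral_prod_left
    have hdiff : ∫ t in Ioo 0 T \ Ioo 0 T₁, I t = 0 := by
      refine setIntegral_eq_zero_of_forall_eq_zero fun t ht => hI0 t ?_
      have h1 : t ∈ Ioo 0 T := ht.1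
      have h2 : t ∉ Ioo 0 T₁ := ht.2
      by_contra hle
      exact h2 ⟨h1.1, lt_of_le_of_lt (not_lt.mp hle) hT'lt⟩
    have hsplit : ∫ t in Ioo 0 T₁, I t = ∫ t in Ioo 0 T, I t := by
      have e := setIntegral_sdiff measurableSet_Ioo hint (Ioo_subset_Ioo_right hT₁)
      rw [hdiff] at e
      linarith
    change (∫ t in Ioo 0 T₁, I t) + ∫ x, θ₀ x * ψ 0 x = 0
    rw [hsplit]
    exact key

/-! ## Testing a weak solution with `η(t) G(t, x)` for a jointly smooth `G` -/

/-- Integrability on `(0,T) × T^d` of `θ(t,x) K(t,x)` for a jointly continuous `K`. [folklore] -/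
theorem integrable_mul_continuous_uncurry (h : IsWeakScalarTransportOn T κ u θ₀ θ)
    {K : ℝ → UnitAddTorus d → ℝ} (hK : Continuous (uncurry K)) :
    Integrable (fun p : ℝ × UnitAddTorus d => θ p.1 p.2 * K p.1 p.2)
      (((volume : Measure ℝ).restrict (Ioo 0 T)).prod volume) := by
  obtain ⟨C, hC⟩ := exists_bound_of_continuous_uncurry hK 0 T
  have hae : ∀ᵐ p : ℝ × UnitAddTorus d ∂(((volume : Measure ℝ).restrict (Ioo 0 T)).prod volume),
      p.1 ∈ Ioo 0 T :=
    (Measure.quasiMeasurePreserving_fst (μ := (volume : Measure ℝ).restrict (Ioo 0 T))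
      (ν := (volume : Measure (UnitAddTorus d)))).ae (ae_restrict_mem measurableSet_Ioo)
  refine h.integrable_uncurry.mul_bdd (c := C) hK.aestronglyMeasurable ?_
  filter_upwards [hae] with p hp
  exact hC p.1 (Ioo_subset_Icc_self hp) p.2

/-- Integrability on `(0,T) × T^d` of `θ(t,x) ⟪u(t,x), K(t,x)⟫` for a jointly continuous vector
field `K`. [folklore] -/
theorem integrable_mul_inner_continuous_uncurry (h : IsWeakScalarTransportOn T κ u θ₀ θ)
    {K : ℝ → UnitAddTorus d → EuclideanSpace ℝ d} (hK : Continuous (uncurry K)) :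
    Integrable (fun p : ℝ × UnitAddTorus d => θ p.1 p.2 * ⟪u p.1 p.2, K p.1 p.2⟫_ℝ)
      (((volume : Measure ℝ).restrict (Ioo 0 T)).prod volume) := by
  obtain ⟨C, hC⟩ := exists_bound_of_continuous_uncurry hK 0 T
  have hae : ∀ᵐ p : ℝ × UnitAddTorus d ∂(((volume : Measure ℝ).restrict (Ioo 0 T)).prod volume),
      p.1 ∈ Ioo 0 T :=
    (Measure.quasiMeasurePreserving_fst (μ := (volume : Measure ℝ).restrict (Ioo 0 T))
      (ν := (volume : Measure (UnitAddTorus d)))).ae (ae_restrict_mem measurableSet_Ioo)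
  have hm : AEStronglyMeasurable (fun p : ℝ × UnitAddTorus d => θ p.1 p.2 * ⟪u p.1 p.2, K p.1 p.2⟫_ℝ)
      (((volume : Measure ℝ).restrict (Ioo 0 T)).prod volume) :=
    h.aestronglyMeasurable_uncurry.mul (h.aestronglyMeasurable_uncurry_velocity.inner hK.aestronglyMeasurable)
  refine (h.integrable_norm_velocity_mul.norm.const_mul C).mono' hm ?_
  filter_upwards [hae] with p hp
  rw [norm_mul, Real.norm_eq_abs, Real.norm_eq_abs, norm_mul, norm_norm, Real.norm_eq_abs]
  calc |θ p.1 p.2| * |⟪u p.1 p.2, K p.1 p.2⟫_ℝ| ≤ |θ p.1 p.2| * (‖u p.1 p.2‖ * C) :=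
        mul_le_mul_of_nonneg_left ((abs_real_inner_le_norm _ _).trans
          (mul_le_mul_of_nonneg_left (hC p.1 (Ioo_subset_Icc_self hp) p.2) (norm_nonneg _))) (abs_nonneg _)
    _ = C * (‖u p.1 p.2‖ * |θ p.1 p.2|) := by ring

variable [DecidableEq d]

/-- Jointly smooth scalar fields on all of `ℝ × T^d`, their time derivatives, gradients and
Laplacians are jointly continuous on `ℝ × T^d`. [folklore] -/
theorem continuous_uncurry_of_isSmoothSpaceTimeOn_univ {G : ℝ → UnitAddTorus d → ℝ}
    (hG : FunctionSpaces.Torus.IsSmoothSpaceTimeOn univ G) :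
    Continuous (uncurry G) ∧
      Continuous (uncurry (FunctionSpaces.Torus.timeDerivWithin univ G)) ∧
      Continuous (uncurry fun t => FunctionSpaces.Torus.gradient (G t)) ∧
      Continuous (uncurry fun t => FunctionSpaces.Torus.laplacian (G t)) := by
  have convR : ∀ {K : ℝ → UnitAddTorus d → ℝ},
      FunctionSpaces.Torus.IsSmoothSpaceTimeOn univ K → Continuous (uncurry K) := by
    intro K hK
    have hc := hK.continuousOn_stLift
    rw [univ_prod_univ, continuousOn_univ] at hc
    exact FunctionSpaces.Torus.continuous_uncurry_of_continuous_stLift hc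
  have convE : ∀ {K : ℝ → UnitAddTorus d → EuclideanSpace ℝ d},
      FunctionSpaces.Torus.IsSmoothSpaceTimeOn univ K → Continuous (uncurry K) := by
    intro K hK
    have hc := hK.continuousOn_stLift
    rw [univ_prod_univ, continuousOn_univ] at hc
    exact FunctionSpaces.Torus.continuous_uncurry_of_continuous_stLift hc
  exact ⟨convR hG, convR (hG.timeDerivWithin uniqueDiffOn_univ), convE (hG.gradient uniqueDiffOn_univ),
    convR (hG.laplacian uniqueDiffOn_univ)⟩

/-- **The weak formulation tested with `η(t) G(t,x)`.** For a smooth compactly supported `η`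
with `tsupport η ⊆ (-∞, T)` and a jointly smooth `G : ℝ × T^d → ℝ`,
`∫_{(0,T)} (η' ∫ θ G + η ∫ θ (∂ₜG + ⟪u, ∇G⟫ + κ ΔG)) dt + η(0) ∫ θ₀ G(0) = 0`
(DiPerna–Lions 1989, §II.1 (14), with a time-dependent test field). [folklore] -/
theorem setIntegral_test_mul_spaceTime (h : IsWeakScalarTransportOn T κ u θ₀ θ) {η : ℝ → ℝ}
    (hη : ContDiff ℝ ∞ η) (hηc : HasCompactSupport η) (hηT : tsupport η ⊆ Iio T)
    {G : ℝ → UnitAddTorus d → ℝ} (hG : FunctionSpaces.Torus.IsSmoothSpaceTimeOn univ G) :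
    (∫ t in Ioo 0 T, ((deriv η t * ∫ x, θ t x * G t x) +
      η t * ∫ x, θ t x * (FunctionSpaces.Torus.timeDerivWithin univ G t x +
        ⟪u t x, FunctionSpaces.Torus.gradient (G t) x⟫_ℝ + κ * FunctionSpaces.Torus.laplacian (G t) x))) +
      η 0 * ∫ x, θ₀ x * G 0 x = 0 := by
  obtain ⟨hGc, hGtc, hGgc, hGlc⟩ := continuous_uncurry_of_isSmoothSpaceTimeOn_univ hG
  -- the test function
  set ψ : ℝ → UnitAddTorus d → ℝ := fun t x => η t * G t x with hψdef
  have hGs : ContDiff ℝ ∞ (FunctionSpaces.Torus.stLift G) := by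
    have h' : ContDiffOn ℝ ∞ (FunctionSpaces.Torus.stLift G) (univ ×ˢ univ) := hG
    rwa [univ_prod_univ, contDiffOn_univ] at h'
  have hψ : FunctionSpaces.Torus.IsSpaceTimeTest T ψ := by
    refine ⟨?_, ?_⟩
    · have e : FunctionSpaces.Torus.stLift ψ = fun p : ℝ × EuclideanSpace ℝ d => η p.1 * FunctionSpaces.Torus.stLift G p := by
        funext p; rfl
      rw [e]
      exact (hη.comp contDiff_fst).mul hGs
    · obtain ⟨T', hT'T, hT'⟩ := FunctionSpaces.exists_lt_forall_eq_zero_of_tsupport_subset_Iio hηc hηT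
      exact ⟨T', hT'T, fun t ht => funext fun x => by simp [hψdef, hT' t ht]⟩
  have key := integral_prod_weak_eq h hψ
  -- pointwise form of the weak integrand
  have hslice : ∀ t, FunctionSpaces.Torus.IsSmooth (G t) := fun t => hG.isSmooth_slice (mem_univ t)
  have hpt : ∀ p : ℝ × UnitAddTorus d, θ p.1 p.2 *
      (FunctionSpaces.Torus.timeDeriv ψ p.1 p.2 +
        ⟪u p.1 p.2, FunctionSpaces.Torus.gradient (ψ p.1) p.2⟫_ℝ +
        κ * FunctionSpaces.Torus.laplacian (ψ p.1) p.2) =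
      deriv η p.1 * (θ p.1 p.2 * G p.1 p.2) +
        η p.1 * (θ p.1 p.2 * (FunctionSpaces.Torus.timeDerivWithin univ G p.1 p.2 +
          ⟪u p.1 p.2, FunctionSpaces.Torus.gradient (G p.1) p.2⟫_ℝ +
          κ * FunctionSpaces.Torus.laplacian (G p.1) p.2)) := by
    intro p
    have hd : FunctionSpaces.Torus.timeDeriv ψ p.1 p.2 =
        deriv η p.1 * G p.1 p.2 + η p.1 * FunctionSpaces.Torus.timeDerivWithin univ G p.1 p.2 := by
      have h1 : HasDerivAt η (deriv η p.1) p.1 := (hη.differentiable (by simp) p.1).hasDerivAt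
      have h2 : HasDerivAt (fun s => G s p.2) (FunctionSpaces.Torus.timeDerivWithin univ G p.1 p.2) p.1 :=
        hasDerivWithinAt_univ.1 (hG.hasDerivWithinAt_slice (mem_univ p.1) p.2)
      exact (h1.mul h2).deriv
    rw [hd, show ψ p.1 = fun x => η p.1 * G p.1 x from rfl,
      gradient_const_mul ((hslice p.1).isContDiff (by simp)), laplacian_const_mul (hslice p.1),
      real_inner_smul_right]
    ring
  set P : Measure (ℝ × UnitAddTorus d) := ((volume : Measure ℝ).restrict (Ioo 0 T)).prod volume with hP
  obtain ⟨Ca, hCa⟩ := (hη.continuous_deriv (by simp)).bounded_above_of_compact_support hηc.deriv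
  obtain ⟨Cb, hCb⟩ := hη.continuous.bounded_above_of_compact_support hηc
  set f₁ : ℝ × UnitAddTorus d → ℝ := fun p => deriv η p.1 * (θ p.1 p.2 * G p.1 p.2) with hf₁
  set f₂ : ℝ × UnitAddTorus d → ℝ := fun p =>
    η p.1 * (θ p.1 p.2 * (FunctionSpaces.Torus.timeDerivWithin univ G p.1 p.2 +
      ⟪u p.1 p.2, FunctionSpaces.Torus.gradient (G p.1) p.2⟫_ℝ +
      κ * FunctionSpaces.Torus.laplacian (G p.1) p.2)) with hf₂
  have hI₁ : Integrable (fun p : ℝ × UnitAddTorus d => θ p.1 p.2 * G p.1 p.2) P :=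
    h.integrable_mul_continuous_uncurry hGc
  have hI₂ : Integrable (fun p : ℝ × UnitAddTorus d => θ p.1 p.2 *
      (FunctionSpaces.Torus.timeDerivWithin univ G p.1 p.2 +
        ⟪u p.1 p.2, FunctionSpaces.Torus.gradient (G p.1) p.2⟫_ℝ +
        κ * FunctionSpaces.Torus.laplacian (G p.1) p.2)) P := by
    have e : (fun p : ℝ × UnitAddTorus d => θ p.1 p.2 *
        (FunctionSpaces.Torus.timeDerivWithin univ G p.1 p.2 +
          ⟪u p.1 p.2, FunctionSpaces.Torus.gradient (G p.1) p.2⟫_ℝ +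
          κ * FunctionSpaces.Torus.laplacian (G p.1) p.2)) =
        fun p => θ p.1 p.2 * FunctionSpaces.Torus.timeDerivWithin univ G p.1 p.2 +
          θ p.1 p.2 * ⟪u p.1 p.2, FunctionSpaces.Torus.gradient (G p.1) p.2⟫_ℝ +
          θ p.1 p.2 * (κ * FunctionSpaces.Torus.laplacian (G p.1) p.2) := by
      funext p; ring
    rw [e]
    exact ((h.integrable_mul_continuous_uncurry hGtc).add
      (h.integrable_mul_inner_continuous_uncurry hGgc)).add
      (h.integrable_mul_continuous_uncurry (K := fun t x => κ * FunctionSpaces.Torus.laplacian (G t) x)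
        (continuous_const.mul hGlc))
  have hf₁i : Integrable f₁ P :=
    hI₁.bdd_mul ((hη.continuous_deriv (by simp)).comp continuous_fst).aestronglyMeasurable
      (Eventually.of_forall fun p => hCa p.1)
  have hf₂i : Integrable f₂ P :=
    hI₂.bdd_mul (hη.continuous.comp continuous_fst).aestronglyMeasurable
      (Eventually.of_forall fun p => hCb p.1)
  have esum : (∫ p, (f₁ p + f₂ p) ∂P) + η 0 * ∫ x, θ₀ x * G 0 x = 0 := by
    have e1 : ∫ p, (f₁ p + f₂ p) ∂P = ∫ p, θ p.1 p.2 *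
        (FunctionSpaces.Torus.timeDeriv ψ p.1 p.2 +
          ⟪u p.1 p.2, FunctionSpaces.Torus.gradient (ψ p.1) p.2⟫_ℝ +
          κ * FunctionSpaces.Torus.laplacian (ψ p.1) p.2) ∂P :=
      integral_congr_ae (Eventually.of_forall fun p => (hpt p).symm)
    have e2 : η 0 * ∫ x, θ₀ x * G 0 x = ∫ x, θ₀ x * ψ 0 x := by
      rw [← integral_const_mul]
      exact integral_congr_ae (Eventually.of_forall fun x => by simp only [hψdef]; ring)
    rw [e1, e2]
    exact key
  have e₁ : ∫ p, f₁ p ∂P = ∫ t in Ioo 0 T, deriv η t * ∫ x, θ t x * G t x := by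
    rw [hP, integral_prod _ hf₁i]
    refine integral_congr_ae (Eventually.of_forall fun t => ?_)
    simp only [hf₁]
    exact integral_const_mul _ _
  have e₂ : ∫ p, f₂ p ∂P = ∫ t in Ioo 0 T, η t * ∫ x, θ t x *
      (FunctionSpaces.Torus.timeDerivWithin univ G t x +
        ⟪u t x, FunctionSpaces.Torus.gradient (G t) x⟫_ℝ + κ * FunctionSpaces.Torus.laplacian (G t) x) := by
    rw [hP, integral_prod _ hf₂i]
    refine integral_congr_ae (Eventually.of_forall fun t => ?_)
    simp only [hf₂]
    exact integral_const_mul _ _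
  have ha : Integrable (fun t => deriv η t * ∫ x, θ t x * G t x) (volume.restrict (Ioo 0 T)) := by
    refine hf₁i.integral_prod_left.congr (Eventually.of_forall fun t => ?_)
    simp only [hf₁]
    exact integral_const_mul _ _
  have hb : Integrable (fun t => η t * ∫ x, θ t x *
      (FunctionSpaces.Torus.timeDerivWithin univ G t x +
        ⟪u t x, FunctionSpaces.Torus.gradient (G t) x⟫_ℝ + κ * FunctionSpaces.Torus.laplacian (G t) x))
      (volume.restrict (Ioo 0 T)) := by
    refine hf₂i.integral_prod_left.congr (Eventually.of_forall fun t => ?_)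
    simp only [hf₂]
    exact integral_const_mul _ _
  rw [integral_add hf₁i hf₂i, e₁, e₂] at esum
  rw [integral_add ha hb]
  exact esum

/-- **Duality with a classical solution of the transport equation.** If `G : ℝ × T^d → ℝ` is
jointly smooth and solves `∂ₜG + u·∇G = 0` on `[0,T) × T^d`, then for a.e. `t ∈ (0,T)`,
`∫ θ(t) G(t) = ∫ θ₀ G(0) + ∫_{(0,t]} κ ∫ θ(τ) ΔG(τ) dτ`
(the weak formulation tested with `η(t) G(t,x)` and the a.e. du Bois-Reymond lemma; this is the
identity `d/dt ∫ θ^κ θ = κ ∫ θ^κ Δθ` of Drivas–Elgindi–Iyer–Jeong 2022, proof of Prop. 1.3, in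
weak form). [cite: DrivasEtAl2022, §2.1, proof of Prop. 1.3] -/
theorem ae_integral_mul_classical_eq (h : IsWeakScalarTransportOn T κ u θ₀ θ)
    {G : ℝ → UnitAddTorus d → ℝ} (hG : FunctionSpaces.Torus.IsSmoothSpaceTimeOn univ G)
    (htr : ∀ t ∈ Ico 0 T, ∀ x, FunctionSpaces.Torus.timeDerivWithin univ G t x +
      ⟪u t x, FunctionSpaces.Torus.gradient (G t) x⟫_ℝ = 0) :
    ∀ᵐ t ∂(volume.restrict (Ioo 0 T)),
      ∫ x, θ t x * G t x = (∫ x, θ₀ x * G 0 x) +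
        ∫ τ in Ioc 0 t, κ * ∫ x, θ τ x * FunctionSpaces.Torus.laplacian (G τ) x := by
  obtain ⟨hGc, hGtc, hGgc, hGlc⟩ := continuous_uncurry_of_isSmoothSpaceTimeOn_univ hG
  have hU : IntegrableOn (fun t => ∫ x, θ t x * G t x) (Ioo 0 T) volume :=
    (h.integrable_mul_continuous_uncurry hGc).integral_prod_left
  have hF' : IntegrableOn (fun t => ∫ x, θ t x * (κ * FunctionSpaces.Torus.laplacian (G t) x)) (Ioo 0 T) volume :=
    (h.integrable_mul_continuous_uncurry (K := fun t x => κ * FunctionSpaces.Torus.laplacian (G t) x)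
      (continuous_const.mul hGlc)).integral_prod_left
  have hF : IntegrableOn (fun t => κ * ∫ x, θ t x * FunctionSpaces.Torus.laplacian (G t) x) (Ioo 0 T) volume := by
    refine hF'.congr_fun (fun t _ => ?_) measurableSet_Ioo
    rw [← integral_const_mul]
    exact integral_congr_ae (Eventually.of_forall fun x => by ring)
  refine FunctionSpaces.ae_eq_add_setIntegral_of_forall_test hU hF fun η hη hηc hηT => ?_
  have key := h.setIntegral_test_mul_spaceTime hη hηc hηT hG
  -- on `(0,T)` the transport equation kills `∂ₜG + ⟪u, ∇G⟫`
  have hred : ∫ t in Ioo 0 T, ((deriv η t * ∫ x, θ t x * G t x) +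
      η t * ∫ x, θ t x * (FunctionSpaces.Torus.timeDerivWithin univ G t x +
        ⟪u t x, FunctionSpaces.Torus.gradient (G t) x⟫_ℝ + κ * FunctionSpaces.Torus.laplacian (G t) x)) =
      ∫ t in Ioo 0 T, (deriv η t * (∫ x, θ t x * G t x) +
        η t * (κ * ∫ x, θ t x * FunctionSpaces.Torus.laplacian (G t) x)) := by
    refine setIntegral_congr_fun measurableSet_Ioo fun t ht => ?_
    have e : ∫ x, θ t x * (FunctionSpaces.Torus.timeDerivWithin univ G t x +
        ⟪u t x, FunctionSpaces.Torus.gradient (G t) x⟫_ℝ + κ * FunctionSpaces.Torus.laplacian (G t) x) =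
        κ * ∫ x, θ t x * FunctionSpaces.Torus.laplacian (G t) x := by
      rw [← integral_const_mul]
      refine integral_congr_ae (Eventually.of_forall fun x => ?_)
      dsimp only
      rw [htr t (Ioo_subset_Ico_self ht) x, zero_add]
      ring
    rw [e]
  rw [hred] at key
  exact key

end IsWeakScalarTransportOn

/-! ## Slice estimates -/

namespace DEIJ

/-- Cauchy–Schwarz in `L²(T^d)`: `|∫ f g| ≤ (∫ f²)^{1/2} (∫ g²)^{1/2}`. [folklore] -/
theorem abs_integral_mul_le_sqrt {f g : UnitAddTorus d → ℝ} (hf : MemLp f 2 volume) (hg : MemLp g 2 volume) :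
    |∫ x, f x * g x| ≤ Real.sqrt (∫ x, f x ^ 2) * Real.sqrt (∫ x, g x ^ 2) := by
  have hf' : MemLp f (ENNReal.ofReal 2) volume := by rwa [ENNReal.ofReal_ofNat]
  have hg' : MemLp g (ENNReal.ofReal 2) volume := by rwa [ENNReal.ofReal_ofNat]
  have h := integral_mul_norm_le_Lp_mul_Lq (μ := volume) Real.HolderConjugate.two_two hf' hg'
  have e2 : ∀ (w : UnitAddTorus d → ℝ), (∫ a, ‖w a‖ ^ (2 : ℝ)) ^ (1 / (2 : ℝ)) = Real.sqrt (∫ a, w a ^ 2) := by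
    intro w
    rw [Real.sqrt_eq_rpow]
    congr 1
    refine integral_congr_ae (Eventually.of_forall fun a => ?_)
    dsimp only
    rw [Real.rpow_two, Real.norm_eq_abs, sq_abs]
  rw [e2, e2] at h
  refine le_trans ?_ h
  calc |∫ x, f x * g x| ≤ ∫ x, |f x * g x| := abs_integral_le_integral_abs
    _ = ∫ x, ‖f x‖ * ‖g x‖ := integral_congr_ae (Eventually.of_forall fun x => by
        simp [abs_mul, Real.norm_eq_abs])

/-- `∫ (f - g)² = ∫ f² - 2 ∫ f g + ∫ g²` in `L²(T^d)`. [folklore] -/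
theorem integral_sub_sq_eq {f g : UnitAddTorus d → ℝ} (hf : MemLp f 2 volume) (hg : MemLp g 2 volume) :
    ∫ x, (f x - g x) ^ 2 = (∫ x, f x ^ 2) - 2 * (∫ x, f x * g x) + ∫ x, g x ^ 2 := by
  have hfg : Integrable (fun x => 2 * (f x * g x)) volume := (hf.integrable_mul hg).const_mul 2
  have hf2 : Integrable (fun x => f x ^ 2) volume := hf.integrable_sq
  have hg2 : Integrable (fun x => g x ^ 2) volume := hg.integrable_sq
  have h12 : Integrable (fun x => f x ^ 2 - 2 * (f x * g x)) volume := hf2.sub hfg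
  have e : (fun x => (f x - g x) ^ 2) = fun x => (f x ^ 2 - 2 * (f x * g x)) + g x ^ 2 := by
    funext x; ring
  rw [e, integral_add h12 hg2, integral_sub hf2 hfg, integral_const_mul]

/-- Hölder in time: `∫⁻ a^{1/2} b^{1/2} ≤ (∫⁻ a)^{1/2} (∫⁻ b)^{1/2}`. [folklore] -/
theorem lintegral_sqrt_mul_sqrt_le {α : Type*} [MeasurableSpace α] {μ : Measure α} {a b : α → ℝ≥0∞}
    (ha : AEMeasurable a μ) (hb : AEMeasurable b μ) :
    ∫⁻ x, a x ^ (1 / 2 : ℝ) * b x ^ (1 / 2 : ℝ) ∂μ ≤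
      (∫⁻ x, a x ∂μ) ^ (1 / 2 : ℝ) * (∫⁻ x, b x ∂μ) ^ (1 / 2 : ℝ) := by
  have h := ENNReal.lintegral_mul_le_Lp_mul_Lq μ Real.HolderConjugate.two_two
    (ha.pow_const (1 / 2 : ℝ)) (hb.pow_const (1 / 2 : ℝ))
  have e : ∀ x : ℝ≥0∞, (x ^ (1 / 2 : ℝ)) ^ (2 : ℝ) = x := fun x => by
    rw [← ENNReal.rpow_mul]; norm_num
  simp only [e] at h
  exact h

variable [DecidableEq d]

/-- **The slice estimate.** If a smooth `G` has balanced growth `‖ΔG‖_{L²} ≤ C ‖∇G‖²_{L²}` and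
`θ ∈ L²` is `L²`-close to `G`, `C ‖θ - G‖_{L²} < 1/2`, then `‖∇θ‖²_{L²} ≥ ‖∇G‖²_{L²} / 4`
(spectral gradient norm of `θ`): `‖∇G‖² = -∫ G ΔG = -∫ θ ΔG + ∫ (θ - G) ΔG
≤ ‖∇θ‖ ‖∇G‖ + ‖θ - G‖ ‖ΔG‖ < ‖∇θ‖ ‖∇G‖ + ‖∇G‖²/2` (the interpolation step of
Drivas–Elgindi–Iyer–Jeong 2022, proof of Prop. 1.3, with all derivatives put on `G`).
[cite: DrivasEtAl2022, §2.1, proof of Prop. 1.3] -/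
theorem ofReal_scalarGradNormSq_div_four_le {θt Gt : UnitAddTorus d → ℝ} (hθ : MemLp θt 2 volume)
    (hG : FunctionSpaces.Torus.IsSmooth Gt) {C : ℝ} (hC : 0 ≤ C)
    (hbal : ∫ x, FunctionSpaces.Torus.laplacian Gt x ^ 2 ≤ (C * scalarGradNormSq Gt) ^ 2)
    (hclose : C * Real.sqrt (∫ x, (θt x - Gt x) ^ 2) < 1 / 2) :
    ENNReal.ofReal (scalarGradNormSq Gt / 4) ≤ eScalarGradNormSq θt := by
  set P := scalarGradNormSq Gt with hPdef
  have hP0 : 0 ≤ P := scalarGradNormSq_nonneg _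
  rcases eq_or_lt_of_le hP0 with hP | hP
  · rw [← hP]; simp
  rcases eq_or_ne (eScalarGradNormSq θt) ⊤ with htop | htop
  · rw [htop]; exact le_top
  set x := (eScalarGradNormSq θt).toReal with hxdef
  have hx : eScalarGradNormSq θt = ENNReal.ofReal x := (ENNReal.ofReal_toReal htop).symm
  have hx0 : 0 ≤ x := ENNReal.toReal_nonneg
  have hGm : MemLp Gt 2 volume := hG.continuous.memLp_of_hasCompactSupport (HasCompactSupport.of_compactSpace _)
  have hΔm : MemLp (FunctionSpaces.Torus.laplacian Gt) 2 volume :=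
    hG.laplacian.continuous.memLp_of_hasCompactSupport (HasCompactSupport.of_compactSpace _)
  have hdm : MemLp (fun y => θt y - Gt y) 2 volume := hθ.sub hGm
  set ρ := Real.sqrt (∫ y, (θt y - Gt y) ^ 2) with hρdef
  set L := Real.sqrt (∫ y, FunctionSpaces.Torus.laplacian Gt y ^ 2) with hLdef
  have hρ0 : 0 ≤ ρ := Real.sqrt_nonneg _
  have hL : L ≤ C * P := by
    rw [hLdef, ← Real.sqrt_sq (mul_nonneg hC hP0)]
    exact Real.sqrt_le_sqrt hbal
  -- (1) `∫ G ΔG = -P`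
  have h1 : ∫ y, Gt y * FunctionSpaces.Torus.laplacian Gt y = -P :=
    integral_mul_laplacian_self_eq_neg_scalarGradNormSq hG
  -- (2) `|∫ θ ΔG| ≤ √x √P`
  have h2 : |∫ y, θt y * FunctionSpaces.Torus.laplacian Gt y| ≤ Real.sqrt x * Real.sqrt P := by
    have h := enorm_integral_mul_laplacian_le hθ hG
    rw [hx, eScalarGradNormSq_eq_ofReal_integral hG, ENNReal.ofReal_rpow_of_nonneg hx0 (by norm_num),
      ENNReal.ofReal_rpow_of_nonneg (integral_nonneg fun _ => sq_nonneg _) (by norm_num),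
      ← ENNReal.ofReal_mul (Real.rpow_nonneg hx0 _), Real.enorm_eq_ofReal_abs,
      ENNReal.ofReal_le_ofReal_iff (mul_nonneg (Real.rpow_nonneg hx0 _)
        (Real.rpow_nonneg (integral_nonneg fun _ => sq_nonneg _) _))] at h
    rw [Real.sqrt_eq_rpow, Real.sqrt_eq_rpow]
    exact h
  -- (3) `|∫ (θ - G) ΔG| ≤ ρ L`
  have h3 : |∫ y, (θt y - Gt y) * FunctionSpaces.Torus.laplacian Gt y| ≤ ρ * L :=
    abs_integral_mul_le_sqrt hdm hΔm
  -- (4) splitting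
  have h4 : ∫ y, (θt y - Gt y) * FunctionSpaces.Torus.laplacian Gt y =
      (∫ y, θt y * FunctionSpaces.Torus.laplacian Gt y) - ∫ y, Gt y * FunctionSpaces.Torus.laplacian Gt y := by
    have hi1 : Integrable (fun y => θt y * FunctionSpaces.Torus.laplacian Gt y) volume := hθ.integrable_mul hΔm
    have hi2 : Integrable (fun y => Gt y * FunctionSpaces.Torus.laplacian Gt y) volume := hGm.integrable_mul hΔm
    rw [← integral_sub hi1 hi2]
    exact integral_congr_ae (Eventually.of_forall fun y => by ring)
  -- combination: `P ≤ √x √P + ρ C P < √x √P + P/2`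
  have hρC : ρ * (C * P) < P / 2 := by
    have : ρ * C < 1 / 2 := by rw [mul_comm]; exact hclose
    nlinarith
  have hmain : P / 2 < Real.sqrt x * Real.sqrt P := by
    have e : P = (∫ y, (θt y - Gt y) * FunctionSpaces.Torus.laplacian Gt y) -
        ∫ y, θt y * FunctionSpaces.Torus.laplacian Gt y := by rw [h4, h1]; ring
    have ha := (abs_le.1 h3).2
    have hb := (abs_le.1 h2).1
    have hc : ρ * L ≤ ρ * (C * P) := mul_le_mul_of_nonneg_left hL hρ0
    linarith
  have hsP : 0 < Real.sqrt P := Real.sqrt_pos.2 hP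
  have h5 : Real.sqrt P / 2 < Real.sqrt x := by
    rw [div_lt_iff₀ (by norm_num : (0 : ℝ) < 2)]
    have e : P / 2 = Real.sqrt P * (Real.sqrt P / 2) := by
      rw [← mul_div_assoc, Real.mul_self_sqrt hP0]
    rw [e] at hmain
    nlinarith
  have h6 : P / 4 < x := by
    have e : P / 4 = (Real.sqrt P / 2) ^ 2 := by rw [div_pow, Real.sq_sqrt hP0]; norm_num
    rw [e, ← Real.sq_sqrt hx0]
    exact pow_lt_pow_left₀ h5 (by positivity) two_ne_zero
  rw [hx]
  exact ENNReal.ofReal_le_ofReal h6.le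

/-- `∫⁻_{(0,t)} ofReal φ = ofReal (∫₀ᵗ φ)` for a continuous nonnegative `φ` and `t ≥ 0`. [folklore] -/
theorem lintegral_ofReal_Ioo_eq {φ : ℝ → ℝ} (hφ : Continuous φ) (hφ0 : ∀ s, 0 ≤ φ s) {t : ℝ} (ht : 0 ≤ t) :
    ∫⁻ s in Ioo 0 t, ENNReal.ofReal (φ s) = ENNReal.ofReal (∫ s in (0 : ℝ)..t, φ s) := by
  rw [intervalIntegral.integral_of_le ht, integral_Ioc_eq_integral_Ioo,
    ofReal_integral_eq_lintegral_ofReal ((hφ.integrableOn_Icc (a := 0) (b := t)).mono_set Ioo_subset_Icc_self)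
      (Eventually.of_forall fun s => hφ0 s)]

/-- **Inviscid criterion for anomalous dissipation of weak solutions** (Drivas–Elgindi–Iyer–Jeong
2022, Prop. 1.3, in the inviscid form of Elgindi–Liss 2024, Prop. 2.1 with `σ = 2`, for *weak*
viscous solutions). Let `u` be a bounded measurable drift on `(0,T) × T^d` and let `g` be an
inviscid scalar which, on every `[0,T₁]`, `T₁ < T`, is the restriction of a jointly smooth
classical solution `G` of `∂ₜG + u·∇G = 0`; assume `‖g(t)‖_{L²} ≤ ‖g(0)‖_{L²}`, unbounded
cumulative enstrophy `∫₀ᵗ ‖∇g‖² → ∞` as `t → T`, and the balanced growth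
`‖Δg(t)‖_{L²} ≤ C ‖∇g(t)‖²_{L²}` on `[0,T)`. Then every weak solution `θ` of
`∂ₜθ + u·∇θ = κΔθ` (`κ > 0`) on `[0,T)` whose `L²` datum satisfies
`‖θ₀ - g(0)‖²_{L²} ≤ 1/(8C²)` dissipates `κ ∫₀ᵀ ‖∇θ‖²_{L²} ≥ 1/(32 C²)`.
Proof: with `χ = 1/(32C²)`, `A = 4χ`, pick `t⋆` with `κ∫₀^{t⋆}‖∇g‖² = A`; if the dissipation were
`< χ`, the duality identity `∫θ(t)g(t) = ∫θ₀g₀ + κ∫₀ᵗ∫θΔg` (`ae_integral_mul_classical_eq`),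
the energy inequality (`lintegral_sq_add_le_holds`) and `|∫θΔg| ≤ ‖∇θ‖‖∇g‖`
(`enorm_integral_mul_laplacian_le`) give `‖θ(t) - g(t)‖² < ‖θ₀ - g₀‖² + 2√(χA) ≤ 1/(4C²)` for
a.e. `t ≤ t⋆`, whence `‖∇θ(t)‖² ≥ ‖∇g(t)‖²/4` (`ofReal_scalarGradNormSq_div_four_le`) and
`κ∫₀^{t⋆}‖∇θ‖² ≥ A/4 = χ`, a contradiction.
[cite: DrivasEtAl2022, Prop. 1.3 and §2.1; cf. Elgindi–Liss arXiv:2309.08576, Prop. 2.1] -/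
theorem le_eScalarDissipation_of_balanced_growth {T : ℝ}
    {u : ℝ → UnitAddTorus d → EuclideanSpace ℝ d} {g : ℝ → UnitAddTorus d → ℝ} {θ₀ : UnitAddTorus d → ℝ}
    {C : ℝ} (hC : 0 < C)
    (hu : MemLp (FunctionSpaces.Torus.stLift u) ∞ (volume.restrict (Ioo 0 T ×ˢ univ)))
    (hg : ∀ T₁ < T, ∃ G : ℝ → UnitAddTorus d → ℝ, FunctionSpaces.Torus.IsSmoothSpaceTimeOn univ G ∧
        (∀ t ≤ T₁, G t = g t) ∧
        ∀ t ∈ Icc 0 T₁, ∀ x, FunctionSpaces.Torus.timeDerivWithin univ G t x +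
          ⟪u t x, FunctionSpaces.Torus.gradient (G t) x⟫_ℝ = 0)
    (hL2 : ∀ t ∈ Ico 0 T, ∫ x, g t x ^ 2 ≤ ∫ x, g 0 x ^ 2)
    (hgrow : ∀ A : ℝ, ∃ t ∈ Ico 0 T, A ≤ ∫ s in (0 : ℝ)..t, scalarGradNormSq (g s))
    (hbal : ∀ t ∈ Ico 0 T, ∫ x, FunctionSpaces.Torus.laplacian (g t) x ^ 2 ≤ (C * scalarGradNormSq (g t)) ^ 2)
    (hθ₀ : MemLp θ₀ 2 volume)
    (hδ : ∫ x, (θ₀ x - g 0 x) ^ 2 ≤ 1 / (8 * C ^ 2))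
    {κ : ℝ} (hκ : 0 < κ) {θ : ℝ → UnitAddTorus d → ℝ} (hθ : IsWeakScalarTransportOn T κ u θ₀ θ) :
    ENNReal.ofReal (1 / (32 * C ^ 2)) ≤ eScalarDissipation κ θ 0 T := by
  set χ : ℝ := 1 / (32 * C ^ 2) with hχ
  set A : ℝ := 4 * χ with hA
  have hχ0 : 0 < χ := by positivity
  have hA0 : 0 < A := by positivity
  have hA8 : A = 1 / (8 * C ^ 2) := by rw [hA, hχ]; field_simp; ring
  by_contra hcon
  have hlt : eScalarDissipation κ θ 0 T < ENNReal.ofReal χ := not_le.mp hcon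
  set Dtot := eScalarDissipation κ θ 0 T with hDtot
  have hDtop : Dtot ≠ ⊤ := hlt.ne_top
  have hDχ : Dtot.toReal < χ := by
    have h := ENNReal.toReal_strict_mono ENNReal.ofReal_ne_top hlt
    rwa [ENNReal.toReal_ofReal hχ0.le] at h
  -- Step 1: the level time `t⋆` with `κ ∫₀^{t⋆} ‖∇g‖² = A`
  obtain ⟨t₁, ht₁, hAt₁⟩ := hgrow (A / κ)
  set T₁ := (t₁ + T) / 2 with hT₁
  have ht₁T₁ : t₁ < T₁ := by rw [hT₁]; linarith [ht₁.2]
  have hT₁T : T₁ < T := by rw [hT₁]; linarith [ht₁.2]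
  have hT₁0 : 0 < T₁ := by linarith [ht₁.1]
  obtain ⟨G, hGs, hGg, hGtr⟩ := hg T₁ hT₁T
  have hGsl : ∀ t, FunctionSpaces.Torus.IsSmooth (G t) := fun t => hGs.isSmooth_slice (mem_univ t)
  set φ : ℝ → ℝ := fun s => scalarGradNormSq (G s) with hφ
  have hφ0 : ∀ s, 0 ≤ φ s := fun s => scalarGradNormSq_nonneg _
  have hφc : Continuous φ := by
    have h1 : FunctionSpaces.Torus.IsSmoothSpaceTimeOn univ (fun t x =>
        ⟪FunctionSpaces.Torus.gradient (G t) x, FunctionSpaces.Torus.gradient (G t) x⟫_ℝ) :=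
      (hGs.gradient uniqueDiffOn_univ).inner (hGs.gradient uniqueDiffOn_univ)
    have h2 := h1.continuousOn_integral convex_univ
    rw [continuousOn_univ] at h2
    refine h2.congr fun s => ?_
    simp only [hφ, scalarGradNormSq]
    exact integral_congr_ae (Eventually.of_forall fun x => real_inner_self_eq_norm_sq _)
  have hφe : ∀ s, eScalarGradNormSq (G s) = ENNReal.ofReal (φ s) := fun s =>
    eScalarGradNormSq_eq_ofReal_integral (hGsl s)
  set Eg : ℝ → ℝ := fun t => ∫ s in (0 : ℝ)..t, φ s with hEg
  have hEgc : Continuous Eg := intervalIntegral.continuous_primitive (fun a b => hφc.intervalIntegrable a b) 0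
  have hEg0 : Eg 0 = 0 := by simp [hEg]
  have hEgt₁ : A / κ ≤ Eg t₁ := by
    refine hAt₁.trans_eq ?_
    simp only [hEg, hφ]
    refine intervalIntegral.integral_congr fun s hs => ?_
    rw [uIcc_of_le ht₁.1] at hs
    show scalarGradNormSq (g s) = scalarGradNormSq (G s)
    rw [hGg s (hs.2.trans ht₁T₁.le)]
  obtain ⟨tstar, htstar, hEstar⟩ : ∃ t ∈ Icc 0 t₁, Eg t = A / κ := by
    have hIVT := intermediate_value_Icc ht₁.1 hEgc.continuousOn
    have hmem : A / κ ∈ Icc (Eg 0) (Eg t₁) := ⟨by rw [hEg0]; positivity, hEgt₁⟩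
    obtain ⟨t, ht, hEt⟩ := hIVT hmem
    exact ⟨t, ht, hEt⟩
  have htstarT₁ : tstar < T₁ := lt_of_le_of_lt htstar.2 ht₁T₁
  have hEgle : ∀ t ∈ Icc 0 tstar, Eg t ≤ A / κ := fun t ht => by
    rw [← hEstar]
    exact intervalIntegral.integral_mono_interval le_rfl ht.1 ht.2
      (Eventually.of_forall fun s => hφ0 s) (hφc.intervalIntegrable 0 tstar)
  -- Step 2: restriction to `[0,T₁)` and the three a.e. facts
  have hθ₁ : IsWeakScalarTransportOn T₁ κ u θ₀ θ := hθ.of_le hT₁T.le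
  have hu₁ : MemLp (FunctionSpaces.Torus.stLift u) ∞ (volume.restrict (Ioo 0 T₁ ×ˢ univ)) :=
    hu.mono_measure (Measure.restrict_mono (prod_mono (Ioo_subset_Ioo_right hT₁T.le) subset_rfl) le_rfl)
  have hEI := IsWeakScalarTransportOn.lintegral_sq_add_le_holds hκ hθ₁ hθ₀ hu₁
  have hdual := hθ₁.ae_integral_mul_classical_eq hGs (fun t ht x => hGtr t ⟨ht.1, ht.2.le⟩ x)
  have hL2θ := hθ₁.ae_memLp_two
  have hDmono : ∀ t, t ≤ T → eScalarDissipation κ θ 0 t ≤ Dtot := fun t ht => by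
    simp only [hDtot, eScalarDissipation]
    exact mul_le_mul' le_rfl (lintegral_mono_set (Ioo_subset_Ioo_right ht))
  -- integrability in time of the duality integrand
  have hcΔ : Continuous (uncurry fun τ x => κ * FunctionSpaces.Torus.laplacian (G τ) x) :=
    continuous_const.mul (IsWeakScalarTransportOn.continuous_uncurry_of_isSmoothSpaceTimeOn_univ hGs).2.2.2
  have hFint : IntegrableOn (fun τ => κ * ∫ x, θ τ x * FunctionSpaces.Torus.laplacian (G τ) x) (Ioo 0 T₁) volume := by
    have h1 : IntegrableOn (fun τ => ∫ x, θ τ x * (κ * FunctionSpaces.Torus.laplacian (G τ) x)) (Ioo 0 T₁) volume :=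
      (hθ₁.integrable_mul_continuous_uncurry
        (K := fun t x => κ * FunctionSpaces.Torus.laplacian (G t) x) hcΔ).integral_prod_left
    refine h1.congr_fun (fun t _ => ?_) measurableSet_Ioo
    rw [← integral_const_mul]
    exact integral_congr_ae (Eventually.of_forall fun x => by ring)
  -- a.e. bound on the duality integrand
  have hFbound : ∀ᵐ τ ∂(volume.restrict (Ioo 0 T₁)),
      ‖κ * ∫ x, θ τ x * FunctionSpaces.Torus.laplacian (G τ) x‖ₑ ≤
        ENNReal.ofReal κ * (eScalarGradNormSq (θ τ) ^ (1 / 2 : ℝ) * eScalarGradNormSq (G τ) ^ (1 / 2 : ℝ)) := by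
    filter_upwards [hL2θ] with τ hτ
    rw [enorm_mul, Real.enorm_eq_ofReal hκ.le]
    exact mul_le_mul' le_rfl (enorm_integral_mul_laplacian_le hτ (hGsl τ))
  have hmeasθ : AEMeasurable (fun s => eScalarGradNormSq (θ s)) (volume.restrict (Ioo 0 T₁)) :=
    hθ₁.aemeasurable_eScalarGradNormSq
  have hmeasG : AEMeasurable (fun s => eScalarGradNormSq (G s)) (volume.restrict (Ioo 0 T₁)) := by
    have e : (fun s => eScalarGradNormSq (G s)) = fun s => ENNReal.ofReal (φ s) := funext hφe
    rw [e]
    exact (ENNReal.measurable_ofReal.comp hφc.measurable).aemeasurable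
  -- Step 3: the pointwise lower bound for a.e. `t ≤ t⋆`
  have hpt : ∀ᵐ t ∂(volume.restrict (Ioo 0 T₁)), t ≤ tstar →
      ENNReal.ofReal (φ t / 4) ≤ eScalarGradNormSq (θ t) := by
    filter_upwards [hEI, hdual, hL2θ, ae_restrict_mem measurableSet_Ioo] with t hEIt hdualt hL2t ht htle
    have htT : t ∈ Ico 0 T := ⟨ht.1.le, ht.2.trans hT₁T⟩
    have hGt : G t = g t := hGg t ht.2.le
    have hG0 : G 0 = g 0 := hGg 0 hT₁0.le
    -- (b) the energy inequality at time `t`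
    have hsq : ∀ {f : UnitAddTorus d → ℝ}, MemLp f 2 volume →
        ∫⁻ x, ‖f x‖ₑ ^ 2 = ENNReal.ofReal (∫ x, f x ^ 2) := by
      intro f hf
      rw [ofReal_integral_eq_lintegral_ofReal hf.integrable_sq (Eventually.of_forall fun x => sq_nonneg _)]
      refine lintegral_congr fun x => ?_
      rw [Real.enorm_eq_ofReal_abs, ← ENNReal.ofReal_pow (abs_nonneg _), sq_abs]
    set Dt := eScalarDissipation κ θ 0 t with hDt
    have hDt_le : Dt ≤ Dtot := hDmono t htT.2.le
    have hDt_top : Dt ≠ ⊤ := ne_top_of_le_ne_top hDtop hDt_le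
    have hEt : ∫ x, θ t x ^ 2 ≤ (∫ x, θ₀ x ^ 2) - 2 * Dt.toReal := by
      rw [hsq hL2t, hsq hθ₀] at hEIt
      have h2 : (2 : ℝ≥0∞) * Dt ≠ ⊤ := ENNReal.mul_ne_top (by simp) hDt_top
      have h := ENNReal.toReal_mono ENNReal.ofReal_ne_top hEIt
      rw [ENNReal.toReal_add ENNReal.ofReal_ne_top h2, ENNReal.toReal_ofReal (integral_nonneg fun _ => sq_nonneg _),
        ENNReal.toReal_ofReal (integral_nonneg fun _ => sq_nonneg _), ENNReal.toReal_mul] at h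
      have e2 : (2 : ℝ≥0∞).toReal = 2 := by simp
      rw [e2] at h
      linarith
    -- (c) the duality term is small
    set It := ∫ τ in Ioc 0 t, κ * ∫ x, θ τ x * FunctionSpaces.Torus.laplacian (G τ) x with hIt
    have hIt_bound : |It| ≤ Real.sqrt (Dtot.toReal * A) := by
      have htI : Ioo 0 t ⊆ Ioo 0 T₁ := Ioo_subset_Ioo_right ht.2.le
      have hFt : IntegrableOn (fun τ => κ * ∫ x, θ τ x * FunctionSpaces.Torus.laplacian (G τ) x) (Ioo 0 t) volume :=
        hFint.mono_set htI
      -- `|It| ≤ ∫ |F|` and `ofReal ∫ |F| = ∫⁻ ‖F‖ₑ`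
      have h1 : |It| ≤ ∫ τ in Ioo 0 t, ‖κ * ∫ x, θ τ x * FunctionSpaces.Torus.laplacian (G τ) x‖ := by
        rw [hIt, integral_Ioc_eq_integral_Ioo]
        exact abs_integral_le_integral_abs.trans_eq (by simp [Real.norm_eq_abs])
      have h2 : ENNReal.ofReal (∫ τ in Ioo 0 t, ‖κ * ∫ x, θ τ x * FunctionSpaces.Torus.laplacian (G τ) x‖) =
          ∫⁻ τ in Ioo 0 t, ‖κ * ∫ x, θ τ x * FunctionSpaces.Torus.laplacian (G τ) x‖ₑ :=
        ofReal_integral_norm_eq_lintegral_enorm hFt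
      -- Hölder in time
      have h3 : ∫⁻ τ in Ioo 0 t, ‖κ * ∫ x, θ τ x * FunctionSpaces.Torus.laplacian (G τ) x‖ₑ ≤
          ENNReal.ofReal κ * ((∫⁻ τ in Ioo 0 t, eScalarGradNormSq (θ τ)) ^ (1 / 2 : ℝ) *
            (∫⁻ τ in Ioo 0 t, eScalarGradNormSq (G τ)) ^ (1 / 2 : ℝ)) := by
        calc ∫⁻ τ in Ioo 0 t, ‖κ * ∫ x, θ τ x * FunctionSpaces.Torus.laplacian (G τ) x‖ₑ
            ≤ ∫⁻ τ in Ioo 0 t, ENNReal.ofReal κ *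
                (eScalarGradNormSq (θ τ) ^ (1 / 2 : ℝ) * eScalarGradNormSq (G τ) ^ (1 / 2 : ℝ)) :=
              lintegral_mono_ae (ae_restrict_of_ae_restrict_of_subset htI hFbound)
          _ = ENNReal.ofReal κ * ∫⁻ τ in Ioo 0 t,
                eScalarGradNormSq (θ τ) ^ (1 / 2 : ℝ) * eScalarGradNormSq (G τ) ^ (1 / 2 : ℝ) := by
              rw [lintegral_const_mul' _ _ ENNReal.ofReal_ne_top]
          _ ≤ _ := mul_le_mul' le_rfl (lintegral_sqrt_mul_sqrt_le
                (hmeasθ.mono_measure (Measure.restrict_mono htI le_rfl))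
                (hmeasG.mono_measure (Measure.restrict_mono htI le_rfl)))
      -- the two factors
      have h4 : ENNReal.ofReal κ * ∫⁻ τ in Ioo 0 t, eScalarGradNormSq (θ τ) ≤ Dtot := hDt_le
      have h5 : ENNReal.ofReal κ * ∫⁻ τ in Ioo 0 t, eScalarGradNormSq (G τ) ≤ ENNReal.ofReal A := by
        have e : ∫⁻ τ in Ioo 0 t, eScalarGradNormSq (G τ) = ENNReal.ofReal (Eg t) := by
          simp_rw [hφe]
          exact lintegral_ofReal_Ioo_eq hφc hφ0 ht.1.le
        rw [e, ← ENNReal.ofReal_mul hκ.le]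
        refine ENNReal.ofReal_le_ofReal ?_
        have := hEgle t ⟨ht.1.le, htle⟩
        rwa [le_div_iff₀' hκ] at this
      have h6 : ENNReal.ofReal κ * ((∫⁻ τ in Ioo 0 t, eScalarGradNormSq (θ τ)) ^ (1 / 2 : ℝ) *
            (∫⁻ τ in Ioo 0 t, eScalarGradNormSq (G τ)) ^ (1 / 2 : ℝ)) ≤
          Dtot ^ (1 / 2 : ℝ) * ENNReal.ofReal A ^ (1 / 2 : ℝ) := by
        have e : ENNReal.ofReal κ * ((∫⁻ τ in Ioo 0 t, eScalarGradNormSq (θ τ)) ^ (1 / 2 : ℝ) *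
            (∫⁻ τ in Ioo 0 t, eScalarGradNormSq (G τ)) ^ (1 / 2 : ℝ)) =
            (ENNReal.ofReal κ * ∫⁻ τ in Ioo 0 t, eScalarGradNormSq (θ τ)) ^ (1 / 2 : ℝ) *
              (ENNReal.ofReal κ * ∫⁻ τ in Ioo 0 t, eScalarGradNormSq (G τ)) ^ (1 / 2 : ℝ) := by
          rw [ENNReal.mul_rpow_of_nonneg _ _ (by norm_num : (0 : ℝ) ≤ 1 / 2),
            ENNReal.mul_rpow_of_nonneg _ _ (by norm_num : (0 : ℝ) ≤ 1 / 2)]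
          have hk : ENNReal.ofReal κ ^ (1 / 2 : ℝ) * ENNReal.ofReal κ ^ (1 / 2 : ℝ) = ENNReal.ofReal κ := by
            rw [← ENNReal.rpow_add_of_nonneg _ _ (by norm_num) (by norm_num)]; norm_num
          calc _ = (ENNReal.ofReal κ ^ (1 / 2 : ℝ) * ENNReal.ofReal κ ^ (1 / 2 : ℝ)) *
                ((∫⁻ τ in Ioo 0 t, eScalarGradNormSq (θ τ)) ^ (1 / 2 : ℝ) *
                  (∫⁻ τ in Ioo 0 t, eScalarGradNormSq (G τ)) ^ (1 / 2 : ℝ)) := by rw [hk]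
            _ = _ := by ring
        rw [e]
        gcongr
      -- back to reals
      have e7 : Dtot ^ (1 / 2 : ℝ) * ENNReal.ofReal A ^ (1 / 2 : ℝ) = ENNReal.ofReal (Real.sqrt (Dtot.toReal * A)) := by
        rw [Real.sqrt_eq_rpow, Real.mul_rpow ENNReal.toReal_nonneg hA0.le,
          ENNReal.ofReal_mul (Real.rpow_nonneg ENNReal.toReal_nonneg _),
          ← ENNReal.ofReal_rpow_of_nonneg ENNReal.toReal_nonneg (by norm_num : (0 : ℝ) ≤ 1 / 2),
          ← ENNReal.ofReal_rpow_of_nonneg hA0.le (by norm_num : (0 : ℝ) ≤ 1 / 2), ENNReal.ofReal_toReal hDtop]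
      have h7 : ENNReal.ofReal |It| ≤ ENNReal.ofReal (Real.sqrt (Dtot.toReal * A)) := by
        calc ENNReal.ofReal |It|
            ≤ ENNReal.ofReal (∫ τ in Ioo 0 t, ‖κ * ∫ x, θ τ x * FunctionSpaces.Torus.laplacian (G τ) x‖) :=
              ENNReal.ofReal_le_ofReal h1
          _ ≤ Dtot ^ (1 / 2 : ℝ) * ENNReal.ofReal A ^ (1 / 2 : ℝ) := by rw [h2]; exact h3.trans h6
          _ = ENNReal.ofReal (Real.sqrt (Dtot.toReal * A)) := e7
      exact (ENNReal.ofReal_le_ofReal_iff (Real.sqrt_nonneg _)).1 h7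
    have hIt_lt : |It| < 2 * χ := by
      calc |It| ≤ Real.sqrt (Dtot.toReal * A) := hIt_bound
        _ < Real.sqrt (χ * A) := Real.sqrt_lt_sqrt (mul_nonneg ENNReal.toReal_nonneg hA0.le)
            (mul_lt_mul_of_pos_right hDχ hA0)
        _ = 2 * χ := by
            rw [hA, show χ * (4 * χ) = (2 * χ) ^ 2 by ring, Real.sqrt_sq (by positivity)]
    -- (d) closeness of `θ(t)` and `g(t)` in `L²`
    have hGtm : MemLp (G t) 2 volume := (hGsl t).continuous.memLp_of_hasCompactSupport (HasCompactSupport.of_compactSpace _)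
    have hG0m : MemLp (G 0) 2 volume := (hGsl 0).continuous.memLp_of_hasCompactSupport (HasCompactSupport.of_compactSpace _)
    have hρ2 : ∫ x, (θ t x - G t x) ^ 2 < 1 / (4 * C ^ 2) := by
      rw [integral_sub_sq_eq hL2t hGtm, hdualt]
      have e0 : ∫ x, (θ₀ x - G 0 x) ^ 2 = (∫ x, θ₀ x ^ 2) - 2 * (∫ x, θ₀ x * G 0 x) + ∫ x, G 0 x ^ 2 :=
        integral_sub_sq_eq hθ₀ hG0m
      have hL2' : ∫ x, G t x ^ 2 ≤ ∫ x, G 0 x ^ 2 := by rw [hGt, hG0]; exact hL2 t htT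
      have hδ' : ∫ x, (θ₀ x - G 0 x) ^ 2 ≤ A := by rw [hG0, hA8]; exact hδ
      have hIt' := (abs_lt.1 hIt_lt).1
      have hDt0 : 0 ≤ Dt.toReal := ENNReal.toReal_nonneg
      have e1 : 1 / (4 * C ^ 2) = A + 4 * χ := by rw [hA8, hχ]; field_simp; ring
      rw [e1]
      linarith
    have hclose : C * Real.sqrt (∫ x, (θ t x - G t x) ^ 2) < 1 / 2 := by
      have h1 : Real.sqrt (∫ x, (θ t x - G t x) ^ 2) < 1 / (2 * C) := by
        have e : 1 / (2 * C) = Real.sqrt (1 / (4 * C ^ 2)) := by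
          rw [show 1 / (4 * C ^ 2) = (1 / (2 * C)) ^ 2 by field_simp; ring, Real.sqrt_sq (by positivity)]
        rw [e]
        exact Real.sqrt_lt_sqrt (integral_nonneg fun _ => sq_nonneg _) hρ2
      calc C * Real.sqrt (∫ x, (θ t x - G t x) ^ 2) < C * (1 / (2 * C)) := mul_lt_mul_of_pos_left h1 hC
        _ = 1 / 2 := by field_simp
    -- (e) the slice estimate
    have hbal' : ∫ x, FunctionSpaces.Torus.laplacian (G t) x ^ 2 ≤ (C * scalarGradNormSq (G t)) ^ 2 := by
      rw [hGt]; exact hbal t htT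
    exact ofReal_scalarGradNormSq_div_four_le hL2t (hGsl t) hC.le hbal' hclose
  -- Step 4: integrate over `(0, t⋆)`
  have hpt' : ∀ᵐ t ∂(volume.restrict (Ioo 0 tstar)), ENNReal.ofReal (φ t / 4) ≤ eScalarGradNormSq (θ t) := by
    have h1 := ae_restrict_of_ae_restrict_of_subset (Ioo_subset_Ioo_right htstarT₁.le) hpt
    filter_upwards [h1, ae_restrict_mem measurableSet_Ioo] with t h1t ht
    exact h1t ht.2.le
  have hint : ENNReal.ofReal (A / κ / 4) ≤ ∫⁻ t in Ioo 0 tstar, eScalarGradNormSq (θ t) := by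
    calc ENNReal.ofReal (A / κ / 4) = ENNReal.ofReal (∫ s in (0 : ℝ)..tstar, φ s / 4) := by
          have e : (∫ s in (0 : ℝ)..tstar, φ s) = A / κ := hEstar
          rw [intervalIntegral.integral_div, e]
      _ = ∫⁻ s in Ioo 0 tstar, ENNReal.ofReal (φ s / 4) :=
          (lintegral_ofReal_Ioo_eq (hφc.div_const 4) (fun s => div_nonneg (hφ0 s) (by norm_num)) htstar.1).symm
      _ ≤ ∫⁻ t in Ioo 0 tstar, eScalarGradNormSq (θ t) := lintegral_mono_ae hpt'
  have hfinal : ENNReal.ofReal χ ≤ Dtot := by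
    calc ENNReal.ofReal χ = ENNReal.ofReal κ * ENNReal.ofReal (A / κ / 4) := by
          rw [← ENNReal.ofReal_mul hκ.le]
          congr 1
          rw [hA]; field_simp
      _ ≤ ENNReal.ofReal κ * ∫⁻ t in Ioo 0 tstar, eScalarGradNormSq (θ t) := mul_le_mul' le_rfl hint
      _ ≤ Dtot := by
          simp only [hDtot, eScalarDissipation]
          exact mul_le_mul' le_rfl (lintegral_mono_set (Ioo_subset_Ioo_right (htstarT₁.le.trans hT₁T.le)))
  exact hcon hfinal


end DEIJ

end Torus

end Literature.Analysis.FluidPDE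

end
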